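import Literature.NumberTheory.Transcendental.CuspValueAlgebraic
import Mathlib.Algebra.Polynomial.Roots
import HarnessLib

/-!
# The asymptotic slope of two unbounded coordinates on a ℚ-relation is algebraic

Companion of `CuspValueAlgebraic.lean`. Let `P ∈ ℚ[Y][X]` be nonzero and let `(u_n, v_n)` be
complex solutions of `P(u_n, v_n) = 0` with `|u_n| → ∞` and `v_n / u_n → β`. Then `β` is algebraic
(`isAlgebraic_of_tendsto_div_of_eval₂_eq_zero`): the substitution `Y ↦ X·Y` turns `P` into a
nonzero `P̃(X, Y) = P(X, XY)` with `P̃(u_n, v_n/u_n) = 0`, to which the value lemma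
`isAlgebraic_of_tendsto_of_eval₂_eq_zero` applies. This identifies the slope `β` of a LINEAR cusp
of a ℚ-curve (`x₂/x₁ → β`) as an algebraic number, the first datum of the arithmetic normal form of
the residual cusp atoms of the crux `RigidCore.SparsityTwo` (line cusp-germ-schneider-sparsity,
stub (★)). [folklore]
-/

noncomputable section

open Filter Polynomial
open _root_.Topology

namespace Literature.NumberTheory.Transcendental

/-- The iterated `eval₂RingHom` evaluation of `P ∈ ℚ[Y][X]` at `(x, y)` agrees with the evaluation used in
`CuspValueAlgebraic` (map coefficients, substitute `Y = y`, then `X = x`). [folklore] -/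
theorem evalBivariate_eq (x y : ℂ) (P : Polynomial (Polynomial ℚ)) :
    (eval₂RingHom (eval₂RingHom (algebraMap ℚ ℂ) y) x) P =
      (P.map (mapRingHom (algebraMap ℚ ℂ))).eval₂ (evalRingHom y) x := by
  simp only [coe_eval₂RingHom, eval₂_map]
  congr 1
  refine Polynomial.ringHom_ext (fun a => ?_) ?_
  · simp
  · simp

/-- The substitution `Y ↦ X·Y` (the ring endomorphism `eval₂RingHom (eval₂RingHom (C ∘ C) (X · C X)) X` of
`ℚ[Y][X]`) satisfies `P̃(u, w) = P(u, u·w)`. [folklore] -/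
theorem evalBivariate_substXY (u w : ℂ) (P : Polynomial (Polynomial ℚ)) :
    (eval₂RingHom (eval₂RingHom (algebraMap ℚ ℂ) w) u)
        ((eval₂RingHom (eval₂RingHom ((C : Polynomial ℚ →+* Polynomial (Polynomial ℚ)).comp (C : ℚ →+* Polynomial ℚ)) (X * C X)) X) P) =
      (eval₂RingHom (eval₂RingHom (algebraMap ℚ ℂ) (u * w)) u) P := by
  change ((eval₂RingHom (eval₂RingHom (algebraMap ℚ ℂ) w) u).comp
      (eval₂RingHom (eval₂RingHom ((C : Polynomial ℚ →+* Polynomial (Polynomial ℚ)).comp (C : ℚ →+* Polynomial ℚ)) (X * C X)) X)) P = _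
  congr 1
  refine Polynomial.ringHom_ext (fun c => ?_) ?_
  · -- constants `c ∈ ℚ[Y]`
    show (eval₂RingHom (eval₂RingHom (algebraMap ℚ ℂ) w) u)
        ((eval₂RingHom (eval₂RingHom ((C : Polynomial ℚ →+* Polynomial (Polynomial ℚ)).comp (C : ℚ →+* Polynomial ℚ)) (X * C X)) X) (C c)) =
      (eval₂RingHom (eval₂RingHom (algebraMap ℚ ℂ) (u * w)) u) (C c)
    have h1 : (eval₂RingHom (eval₂RingHom ((C : Polynomial ℚ →+* Polynomial (Polynomial ℚ)).comp (C : ℚ →+* Polynomial ℚ)) (X * C X)) X) (C c) =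
        eval₂RingHom ((C : Polynomial ℚ →+* Polynomial (Polynomial ℚ)).comp (C : ℚ →+* Polynomial ℚ))
          (X * C X) c := by
      simp
    have h2 : (eval₂RingHom (eval₂RingHom (algebraMap ℚ ℂ) (u * w)) u) (C c) =
        eval₂RingHom (algebraMap ℚ ℂ) (u * w) c := by
      simp
    rw [h1, h2]
    show ((eval₂RingHom (eval₂RingHom (algebraMap ℚ ℂ) w) u).comp
        (eval₂RingHom ((C : Polynomial ℚ →+* Polynomial (Polynomial ℚ)).comp (C : ℚ →+* Polynomial ℚ))
          (X * C X))) c =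
      (eval₂RingHom (algebraMap ℚ ℂ) (u * w)) c
    congr 1
    refine Polynomial.ringHom_ext (fun a => ?_) ?_
    · simp
    · simp
      ring
  · show (eval₂RingHom (eval₂RingHom (algebraMap ℚ ℂ) w) u)
        ((eval₂RingHom (eval₂RingHom ((C : Polynomial ℚ →+* Polynomial (Polynomial ℚ)).comp (C : ℚ →+* Polynomial ℚ)) (X * C X)) X) X) =
      (eval₂RingHom (eval₂RingHom (algebraMap ℚ ℂ) (u * w)) u) X
    simp

/-- A bivariate rational polynomial vanishing at all complex points `(u, v)` with `u ≠ 0` is zero.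
[folklore] -/
theorem eq_zero_of_forall_evalBivariate_eq_zero (P : Polynomial (Polynomial ℚ))
    (h : ∀ u v : ℂ, u ≠ 0 → (eval₂RingHom (eval₂RingHom (algebraMap ℚ ℂ) v) u) P = 0) :
    P = 0 := by
  -- for fixed `v`, the polynomial in `u` has infinitely many roots
  have hcoef : ∀ (v : ℂ) (i : ℕ), eval₂ (algebraMap ℚ ℂ) v (P.coeff i) = 0 := by
    intro v i
    set Q : ℂ[X] := P.map (eval₂RingHom (algebraMap ℚ ℂ) v) with hQ
    have hQeval : ∀ u, Q.eval u = (eval₂RingHom (eval₂RingHom (algebraMap ℚ ℂ) v) u) P := fun u => by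
      rw [hQ, eval_map, coe_eval₂RingHom]
    have hQ0 : Q = 0 := by
      apply Polynomial.eq_zero_of_infinite_isRoot
      apply ((Set.finite_singleton (0 : ℂ)).infinite_compl).mono
      intro u hu
      rw [Set.mem_compl_iff, Set.mem_singleton_iff] at hu
      rw [Set.mem_setOf_eq, IsRoot.def, hQeval u]
      exact h u v hu
    have := congrArg (fun q => q.coeff i) hQ0
    simpa [hQ, coeff_map] using this
  ext i n
  -- `P.coeff i ∈ ℚ[Y]` vanishes at every complex number, hence is zero
  have hci : (P.coeff i).map (algebraMap ℚ ℂ) = 0 := by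
    apply Polynomial.eq_zero_of_infinite_isRoot
    refine Set.infinite_univ.mono fun v _ => ?_
    rw [Set.mem_setOf_eq, IsRoot.def, eval_map]
    exact hcoef v i
  have : P.coeff i = 0 :=
    (Polynomial.map_eq_zero_iff (algebraMap ℚ ℂ).injective).mp hci
  simp [this]

/-- The substitution `Y ↦ X·Y` kills no nonzero polynomial: `P(X, XY) = 0` forces `P = 0`. [folklore] -/
theorem substXY_ne_zero {P : Polynomial (Polynomial ℚ)} (hP : P ≠ 0) :
    (eval₂RingHom (eval₂RingHom ((C : Polynomial ℚ →+* Polynomial (Polynomial ℚ)).comp (C : ℚ →+* Polynomial ℚ)) (X * C X)) X) P ≠ 0 := by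
  intro h0
  apply hP
  apply eq_zero_of_forall_evalBivariate_eq_zero
  intro u v hu
  have := evalBivariate_substXY u (v / u) P
  rw [h0, map_zero, mul_div_cancel₀ v hu] at this
  exact this.symm

/-- **The asymptotic slope is algebraic.** Let `P ∈ ℚ[Y][X]` be nonzero and `u v : ℕ → ℂ` with
`‖u n‖ → ∞`, `v n / u n → β` and `P(u n, v n) = 0` for all `n`. Then `β` is algebraic over `ℚ`.
[folklore] -/
theorem isAlgebraic_of_tendsto_div_of_eval₂_eq_zero (P : Polynomial (Polynomial ℚ)) (hP : P ≠ 0)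
    {u v : ℕ → ℂ} {β : ℂ} (hu : Tendsto (fun n => ‖u n‖) atTop atTop)
    (hβ : Tendsto (fun n => v n / u n) atTop (𝓝 β))
    (h : ∀ n, (P.map (mapRingHom (algebraMap ℚ ℂ))).eval₂ (evalRingHom (v n)) (u n) = 0) :
    IsAlgebraic ℚ β := by
  -- discard the finitely many `n` with `u n = 0`
  obtain ⟨n₀, hn₀⟩ : ∃ n₀, ∀ n ≥ n₀, u n ≠ 0 := by
    have hev : ∀ᶠ n in atTop, 1 ≤ ‖u n‖ := hu.eventually (eventually_ge_atTop 1)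
    obtain ⟨n₀, hn₀⟩ := eventually_atTop.mp hev
    exact ⟨n₀, fun n hn h0 => by have := hn₀ n hn; rw [h0, norm_zero] at this; linarith⟩
  set u' : ℕ → ℂ := fun n => u (n + n₀) with hu'
  set w' : ℕ → ℂ := fun n => v (n + n₀) / u (n + n₀) with hw'
  refine isAlgebraic_of_tendsto_of_eval₂_eq_zero
    ((eval₂RingHom (eval₂RingHom ((C : Polynomial ℚ →+* Polynomial (Polynomial ℚ)).comp (C : ℚ →+* Polynomial ℚ)) (X * C X)) X) P)
    (substXY_ne_zero hP) (u := u') (v := w')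
    (hu.comp (tendsto_add_atTop_nat n₀)) (hβ.comp (tendsto_add_atTop_nat n₀)) fun n => ?_
  have hne : u (n + n₀) ≠ 0 := hn₀ _ (Nat.le_add_left _ _)
  rw [← evalBivariate_eq, hu', hw', evalBivariate_substXY, mul_div_cancel₀ _ hne, evalBivariate_eq]
  exact h (n + n₀)

end Literature.NumberTheory.Transcendental

end
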